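import Mathlib
import HarnessLib
import HarnessLib.Audit
import Summits.ResolutionOfSingularities.Statement
import Literature.AlgebraicGeometry.Resolution.ComponentGluing
import HarnessLib.Audit.Status.Attr

/-!
Route: SeparableGalois

# Route SeparableGalois — de Jong without Frobenius — birational Galois-quotient models, then
resolve wild quotients

LENS 3.10 (weakest-unknown-consequence), USE (P), cycle 2. It suffices to show X = W ∧ K ∧ D. W =
GaloisQuotientModels (crux 2, the
NEW consequence of the summit filed this cycle; `S → W` proved sorry-free in the planner's
Sketch.lean, `galoisQuotientModels_of_summit`):
over every PERFECT field of characteristic p, every integral separated finite-type X admits a proper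
BIRATIONAL π : X₁ → X where X₁ is a
Galois-type quotient of a REGULAR integral X′ by a finite group G (q : X′ → X₁ finite, surjective,
generically étale, G-invariant, fibres =
orbits — verbatim the hypotheses of K). K = WildQuotientResolution (crux 3, SHARED by signature with
route WildQuotients, stmt-15640): such
X₁ are resolvable. D = DescentPerfectToAll (crux 4, shared, stmt-0549): perfect fields suffice. No
idea card is realised (lens output).
W is de Jong's Galois alteration theorem (DeJong1997 Thm 5.13 / Cor 5.15, AbramovichOort2000 Thm 2.8
/ Cor 2.9) with its purely
inseparable defect REMOVED — the statement AbramovichOort2000 Question 2.13 does not dare to ask and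
Temkin2017 §1.2.1 disclaims.
Lean: `GaloisQuotientModels ∧ WildQuotientResolution ∧ DescentPerfectToAll`

## Assembly
Pure logic plus two PROVED narrow-import Literature lemmas (Sketch.lean = glue.lean: lean check rc
0, 0 sorries, `closes` axioms propext ·
Classical.choice · Quot.sound): unfold `ResolutionOfSingularities_iff`, fix p prime;
`DescentPerfectToAll p hp` reduces `ResolutionInChar p`
to reduced separated finite-type X over PERFECT k;
`Literature.AlgebraicGeometry.Resolution.ComponentGluing.hasResolution_of_forall_closeds`
(Cossart–Piltant 2019 Prop 4.6 Step 1, proved) reduces to the integral closed subschemes Z ↪ X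
(again separated of finite type over k);
`GaloisQuotientModels` gives π : X₁ → Z proper birational with its Galois-quotient presentation q :
X′ → X₁; X₁ → Z → X → Spec k is
separated, locally of finite type and quasi-compact (instances from properness), so
`WildQuotientResolution` resolves X₁; the proved
`ComponentGluing.Scheme.HasResolution.of_isBirational` transports the resolution down π. Every crux
is a binder of `closes` and is used.
Certificates that each crux is a CONSEQUENCE of the summit (lens 3.10):
`galoisQuotientModels_of_summit`, `wildQuotientResolution_of_summit`,
`descentPerfectToAll_of_summit` (Sketch.lean, sorry-free) — the route is an exact partition of the
Statement.

Rationale: WHY THIS LINE. Every alteration theorem stops at "resolved up to quotient singularities AND a purely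
inseparable extension of R(X)" (DeJong1997 Cor 5.15),
and every existing route pays for the inseparable half with the radicial crux Picover (pAlteration,
WildQuotient(s), RadicialJung) — the
class where α_p-torsors, kangaroo points and unbounded residual orders live. Reading DeJong1997
§§2–5 locates the inseparability exactly:
Thm 2.4 (vi) makes the alteration generically étale as soon as condition (2.1.1) holds (generic
fibre smooth, marked subset étale), Rem
2.3 (ii) then gives EQUALITY R(X)^G = R(X′)^{G′}, and over a perfect ground field the induction
bases of Thm 5.9 are points — so the whole
defect comes from forcing (2.1.1) by purely inseparable normalisation (§2.7 Lemma 2.8, Lemma 5.5,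
first line of the proof of 5.9), i.e.
from fiercely ramified fixed divisors (AbramovichOort2000 Ex. 5.16). The lever is to achieve (2.1.1)
EQUIVARIANTLY instead — verticalise
the finitely many fiercely ramified divisors in the fibration and absorb residual inseparability
into the Stein factor (the equivariant
fibration lemma EFL, typed as the first stub of W's birth skeleton) — which conjecturally makes de
Jong's Galois alteration BIRATIONAL on
quotients; then the summit over perfect fields IS the wild-quotient problem K, with no radicial
cover ever resolved. Imported: alterations
and moduli of stable curves (DeJong1996, DeJong1997), ramification theory of fierce extensions
(KnafKuhlmann2009, Temkin2017), quotients by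
finite groups (SGA1 V.1, BerghRydh2019). Negatives index: empty at filing.

RANKED CRUXES. #2 GaloisQuotientModels (crux) — for every prime p, every PERFECT field k of
characteristic p and every integral separated k-scheme X of finite type there are a proper
birational π : X₁ → X, a regular integral X′ with a finite group G acting, and a finite surjective
generically étale G-invariant q : X′ → X₁ whose fibres are G-orbits (X₁ integral) — a BIRATIONAL
Galois-quotient model (de Jong's Galois alteration with the purely inseparable defect removed).
[difficulty: L] (why it might fail: Fiercely ramified fixed divisors with ≥ 2 inseparable residue
directions ((Z/p)^s translations, s ≥ 3) may obstruct (2.1.1) for EVERY equivariant fibration,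
forcing de Jong's inseparable base change; no other mechanism is known (Temkin2017 §1.2.1 disclaims
Galois control).) [DeJong1997, DeJong1996, AbramovichOort2000, arXiv:math/9806100, Temkin2017,
arXiv:1508.06255, KnafKuhlmann2009, SGA1, BerghRydh2019]
#3 WildQuotientResolution (crux) — (shared verbatim with route WildQuotients,
stmt-ResolutionOfSingularities-15640) for every prime p and every field k of characteristic p, every
integral separated finite-type X₁ that is a Galois-type quotient of a REGULAR integral X′ by a
finite group (q : X′ → X₁ finite surjective generically étale, G-invariant, fibres = orbits) has a
resolution. [difficulty: open-problem] (why it might fail: Unknown from dim 4 for every p; wild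
quotients are non-CM once codim(Fix) ≥ 3 (Ellingsrud–Skjelbred); the plain Kiraly–Lütkebohmert
blow-up game cycles for p ≥ 5 (card tame-ghost v2 kit jobs); non-solvable stabilisers (SL₂(F_p))
lack any regularity criterion.) [DeJong1997, KiralyLutkebohmert2013, BerghRydh2019,
LorenziniSchroer2019, AbramovichTemkinWlodarczyk2024, arXiv:2106.11526]
#4 DescentPerfectToAll (crux) — (shared verbatim with route Descent,
stmt-ResolutionOfSingularities-0549) for every prime p, resolution of all reduced separated
finite-type schemes over all PERFECT fields of characteristic p implies ResolutionInChar p.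
[difficulty: open-problem] (why it might fail: Only known mechanism spreads X over a f.g. field of
definition and base-changes back, which needs separability; regular is not geometrically regular
under inseparable extension (EGA IV 6.7.4), e.g. k = F_p((t)); 15 crux lines already died on it.)
[arXiv:math/0703678, doi:10.1016/j.jalgebra.2008.11.030,
Literature.Barriers.ResolutionOfSingularities.InseparableBaseChange, EGAIV2, StacksProject]

TWO-LAYER PLAN. Foreseen glued split of GaloisQuotientModels once work starts (its birth skeleton,
bc/GaloisQuotientModels_birth.lean, lean check rc 0,
sorries = stubs = 2): GaloisQuotientModels ⇐ EquivariantFibration → (EquivariantFibration →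
GaloisQuotientModels) — EFL (the new lemma,
typed: equivariant modification + equivariant proper fibration onto a variety of one dimension less
with SMOOTH generic fibre and ÉTALE
marked generic fibre, over an infinite perfect field) and the de Jong 1997 §§2–5 re-run (transfer
stub, XL; finite fields through a finite
Galois extension of the ground field, quotient by SGA1 V.1). Nothing filed now.

KILL CRITERIA. All three cruxes are PROVED consequences of the Statement, so a refutation of any of
them refutes the summit itself (close
`refuted:<Decl>` and hand the witness to route WildPurity's negative programme). The route-specific
death is softer: if EFL is shown
impossible (a (Z/p)^s-translation specimen, s ≥ 3, on which NO equivariant fibration satisfies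
(2.1.1)), GaloisQuotientModels loses its
only attack — pivot to the p.i. fallback (= route WildQuotients) and retire this route `superseded
--by route-ResolutionOfSingularities-WildQuotients`.
If GaloisQuotientModels turns out to be already a theorem in print (Gabber–Illusie–Temkin circle),
it is re-kinded support and the route
becomes the then-PROVED reduction "summit over perfect fields ⟺ WildQuotientResolution" — kept, not
killed. WQ or Descent proved elsewhere
only helps.

NOT DECOMPOSED YET. EFL's internal steps (Bertini with base conditions on Y/G for the generic-fibre
smoothness; the finite-field case; geometric
irreducibility via Stein factorisation; exceptional divisors over closed base points are never
fierce; the 'absorb into the Stein factor'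
move for multiply-fierce divisors); the bookkeeping of de Jong 1997 5.7/5.11–5.13 in separable form;
the SGA1 V.1 quotient and its
generic étaleness (tree: Literature.AlgebraicGeometry.RelativeSpec.FiniteGroupQuotientGenericEtale).
All layer-2, after the crux moves.

CHEAPEST FALSIFIER. (a) LOOKUP (run, negative so far): is "de Jong's Galois alteration can be taken
with R(X′)^G = R(X) over a perfect field" in print?
AbramovichOort2000 p. 9 Question 2.13 asks only for weak resolution "up to purely inseparable
alterations"; Temkin2017 §1.2.1 "we do not
achieve that b is Galois"; DeJong1997 5.13/5.15 state p.i.; zbMATH/arXiv "Galois alteration" (15 + 4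
hits) and galaxy (2 hits) show no
separable-Galois version. (b) COMPUTATION (hand, done for s = 1, 2; s = 3 open — kit-sized): for Y =
A^(s+1), G = (Z/p)^s acting by
y_i ↦ y_i + x (the fiercest translation specimens, AbramovichOort2000 Ex 5.16 is s = 1), exhibit
G-invariant t₁..t_s with smooth Stein
generic fibre: s = 1: t = x works; s = 2: t = (x, N₁), N₁ = y₁^p − x^(p−1)y₁, Stein factor K(y₁),
generic fibre P¹ — works; whereas
t = (x, N₁ + xN₂) FAILS for p ≥ 3 (local ring z^p = u·s^(p−1) at infinity). A refuter settles s = 3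
this week.

NUMBERS. Items at open: 4 (3 cruxes + assembly). Cone of `closes`: 3 open cruxes, all load-bearing.
Known cases of W: characteristic 0
(AbramovichJong / AbramovichOort2000 Thm 2.11: there X′/G → X IS birational), dimension ≤ 3 in char
p (via CossartPiltant2019, trivial
group; bc/GaloisQuotientModels_special.lean), regular X (trivial). Degrees: Temkin2017 Thm 1.2.5
gives separable p-power-degree REGULAR
alterations over perfect k (not Galois); Gabber (IllusieLaszloOrgogozo2014 Exp. X) prime-to-ℓ; de
Jong 1997: Galois but R(X′)^G/R(X) p.i.

DEFINITION REQUESTS. None: every notion is typed over Mathlib (Scheme, Aut, Etale, IsFinite,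
PerfectField) and Literature.AlgebraicGeometry.Resolution
(IsBirational, Scheme.IsRegular, Scheme.HasResolution, ResolutionInChar).

Novelty: Searches (2026-08-17): `lit search "Galois alteration" --source zbmath` (15: Temkin2017, Jannsen
2016, Pop 2000 "Alterations and birational
anabelian geometry", Illusie surveys — none separable-Galois); `--source arxiv` (4); `lit galaxy
search "Galois alteration" --star all` (2:
Cisinski–Déglise, ANT masthead); `lit galaxy search "Galois alteration birational quotient" --star
all` (0); local hybrid index down
(ConnectionReset, 3 retries) — compensated by full reads: AbramovichOort2000 (arXiv:math/9806100 pp.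
8–9, 17–18), DeJong1997
(doi:10.5802/aif.1575 pp. 3–7, 16–21), Temkin2017 (arXiv:1508.06255 §1, §4); `lean search`
GaloisQuotientAlteration / generically étale
(tree: stmt-16323 = the p.i. version; Literature.…Alterations vendors DeJong1996 weak form); all 32
Theses headers read; ledger negatives (0).
Nearest prior art found: DeJong1997 Thm 5.13 / Cor 5.15 and AbramovichOort2000 Cor 2.9 (Galois
alteration, quotient map purely
inseparable), Question 2.13 loc. cit. (asks for the p.i. fallback only); Temkin2017 Thm 1.2.5
(separable p-alteration, not Galois); in the
ledger: WildQuotients.GaloisQuotientAlteration stmt-16323 (p.i. version, support) and WildQuotients'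
assembly WQ ∧ Picover ∧ SummitReduction.
Delta: the purely inseparable defect of de Jong's Galois alteration is conjectured removable over
perfect fields by an equivariant
fibration lemma that verticalises fierce ramification (located at DeJong1997 (2.1.1)/Lemma 2.8), so
the summit reduces to wild quotient
singular  [refs: 10.5802/aif.1575, math/9806100, 1508.06255, doi:10.5802/aif.1575, Temkin2017, AbramovichOort2000, DeJong1997, DeJong1996]

Barriers (technique_class: galois-alteration, wild-quotient, stable-curves): - technique_class: galois-alteration, wild-quotient, stable-curves
- Literature.Barriers.ResolutionOfSingularities.InseparableBaseChangeResolution: evaded by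
construction — the route's entire point is to REMOVE the purely inseparable base change from de
Jong's induction (EFL replaces §2.7 Lemma 2.8); no regularity is ever transported along an
inseparable extension; D (Descent) is where the barrier still bites, shared with 12 routes.
- Literature.Barriers.ResolutionOfSingularities.RegularNotGeometricallyRegular: it is the phenomenon
EFL must dodge (regular non-smooth generic fibres over the function field of the base, Kollár 1.19);
the bet is that over a PERFECT ground field the non-smooth points of equivariant generic fibres are
exactly the fiercely ramified horizontal divisors, finitely many, hence verticalisable.
- Literature.Barriers.ResolutionOfSingularities.FrobeniusTwistResolution: no Frobenius twist or
radicial cover is resolved anywhere in the line (Picover is NOT an item); conceded that it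
constrains D.
- Literature.Barriers.ResolutionOfSingularities.DimensionFourFrontier: evaded in architecture — no
local uniformization, no Zariski patching, no induction through LU_4; de Jong's induction is on
fibre dimension through moduli of stable curves.
- Literature.Barriers.ResolutionOfSingularities.KangarooShadeIncreaseNarrow: no order invariant, no
maximal contact, no cleaning gauge in W; conceded that whoever attacks K by blow-ups meets it again,
inside the narrower class o

History (route lifecycle, newest last):
- 2026-08-25T07:10:13Z · DORMANT — reconciler: no traction for 7.5 d (last activity item-evidence-added at 2026-08-17T19:04:39Z); parked, not closed — `ledger route dormant route-ResolutionOfSing (operator:999:3994558)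
- 2026-08-26T17:02:21Z · REACTIVATED — reconciler: reactivated — activity statement-claimed at 2026-08-26T16:25:04Z after parking at 2026-08-25T07:10:13Z (operator:999:3625779)

sub-problem: ResolutionOfSingularities · status: open · opened planner-plan-lens3-ResolutionOfSingularities-wuc-g2-0 2026-08-17T03:09:29Z · rev 1 · ledger route-ResolutionOfSingularities-SeparableGalois
GENERATED by the gate from the ledger (D-0016/17). Provers cite these decls: `theorem foo : Summit.ResolutionOfSingularities.ResolutionOfSingularities.Theses.SeparableGalois.<Decl> := …` in Summits/ResolutionOfSingularities/ResolutionOfSingularities/Theorems/<Name>.lean.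
-/

namespace Summit.ResolutionOfSingularities.ResolutionOfSingularities.Theses.SeparableGalois

open scoped BigOperators Topology Manifold Classical MeasureTheory ProbabilityTheory Matrix InnerProductSpace ComplexConjugate ContinuousMap
open Filter Set Function TopologicalSpace MeasureTheory

attribute [summit_statement] _root_.ResolutionOfSingularities

/-- item stmt-ResolutionOfSingularities-18955 · crux · rank 2 · open · by planner
why it might fail: Fiercely ramified fixed divisors with ≥ 2 inseparable residue directions ((Z/p)^s translations, s ≥ 3) may obstruct (2.1.1) for EVERY equivariant fibration, forcing de Jong's inseparable base change; no other mechanism is known (Temkin2017 §1.2.1 disclaims Galois control).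
sources: DeJong1997, DeJong1996, AbramovichOort2000, arXiv:math/9806100, Temkin2017, arXiv:1508.06255
[crux] for every prime p, every PERFECT field k of characteristic p and every integral separated
k-scheme X of finite type there are a proper birational π : X₁ → X, a regular integral X′ with a
finite group G acting, and a finite surjective generically étale G-invariant q : X′ → X₁ whose
fibres are G-orbits (X₁ integral) — a BIRATIONAL Galois-quotient model (de Jong's Galois alteration
with the purely inseparable defect removed). [difficulty: L] -/
@[route_item "route-ResolutionOfSingularities-SeparableGalois", crux]
def GaloisQuotientModels : Prop :=
  ∀ p : ℕ, p.Prime → ∀ (k : Type) [Field k] [CharP k p] [PerfectField k] (X : AlgebraicGeometry.Scheme.{0}) (f : X ⟶ AlgebraicGeometry.Spec (.of k)), AlgebraicGeometry.IsSeparated f → AlgebraicGeometry.LocallyOfFiniteType f → AlgebraicGeometry.QuasiCompact f → AlgebraicGeometry.IsIntegral X → ∃ (X₁ X' : AlgebraicGeometry.Scheme.{0}) (π : X₁ ⟶ X) (q : X' ⟶ X₁) (G : Type) (_ : Group G) (_ : Finite G) (ρ : G →* CategoryTheory.Aut X'), AlgebraicGeometry.IsProper π ∧ Literature.AlgebraicGeometry.Resolution.IsBirational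 π ∧ AlgebraicGeometry.IsIntegral X₁ ∧ AlgebraicGeometry.IsIntegral X' ∧ Literature.AlgebraicGeometry.Resolution.Scheme.IsRegular X' ∧ AlgebraicGeometry.IsFinite q ∧ Function.Surjective q.base ∧ (∃ U : X₁.Opens, Dense (U : Set X₁) ∧ AlgebraicGeometry.Etale (AlgebraicGeometry.morphismRestrict q U)) ∧ (∀ g : G, CategoryTheory.CategoryStruct.comp (ρ g).hom q = q) ∧ (∀ x y : X', q.base x = q.base y → ∃ g : G, (ρ g).hom.base x = y)

/-- item stmt-ResolutionOfSingularities-15640 · crux · rank 3 · open · by planner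
why it might fail: Unknown from dim 4 for every p; wild quotients are non-CM once codim(Fix) ≥ 3 (Ellingsrud–Skjelbred); the plain Kiraly–Lütkebohmert blow-up game cycles for p ≥ 5 (card tame-ghost v2 kit jobs); non-solvable stabilisers (SL₂(F_p)) lack any regularity criterion.
sources: DeJong1997, KiralyLutkebohmert2013, BerghRydh2019, LorenziniSchroer2019, AbramovichTemkinWlodarczyk2024, arXiv:2106.11526
[crux] DODGE at the de Jong/Gabber death point: for every field k of char p, every REGULAR integral
X′ with an action ρ of a finite group G over an integral separated finite-type X₁ — q : X′ → X₁
finite, surjective, étale over a dense open, ρ(g) ≫ q = q, fibres of q = G-orbits (so X₁ = X′/G up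
to normalization) — the scheme X₁ has a resolution. Intended line (card
tame-ghost-of-a-wild-action-v2): equivariant residue-weighted blow-ups of X′ in fixed-point strata
until the augmentation ideals of the p-cyclic steps are invertible (KiralyLutkebohmert ⇒ regular
quotient), central series for p-groups, Bergh–Rydh for tame stabilisers. [difficulty: open-problem] -/
@[route_item "route-ResolutionOfSingularities-SeparableGalois", crux]
def WildQuotientResolution : Prop :=
  ∀ p : ℕ, p.Prime → ∀ (k : Type) [Field k] [CharP k p] (X' X₁ : AlgebraicGeometry.Scheme.{0}) (f : X₁ ⟶ AlgebraicGeometry.Spec (.of k)) (q : X' ⟶ X₁) (G : Type) [Group G] [Finite G] (ρ : G →* CategoryTheory.Aut X'), AlgebraicGeometry.IsSeparated f → AlgebraicGeometry.LocallyOfFiniteType f → AlgebraicGeometry.QuasiCompact f → AlgebraicGeometry.IsIntegral X₁ → AlgebraicGeometry.IsIntegral X' → Literature.AlgebraicGeometry.Resolution.Scheme.IsRegular X' → AlgebraicGeometry.IsFinite q → Function.Surjective q.base → (∃ U : X₁.Opens, Dense (U : Set X₁) ∧ AlgebraicGeometry.Etale (AlgebraicGeometry.morphismRestrict q U)) → (∀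 g : G, CategoryTheory.CategoryStruct.comp (ρ g).hom q = q) → (∀ x y : X', q.base x = q.base y → ∃ g : G, (ρ g).hom.base x = y) → Literature.AlgebraicGeometry.Resolution.Scheme.HasResolution X₁

/-- item stmt-ResolutionOfSingularities-0549 · crux · rank 4 · open · by planner
why it might fail: Only known mechanism spreads X over a f.g. field of definition and base-changes back, which needs separability; regular is not geometrically regular under inseparable extension (EGA IV 6.7.4), e.g. k = F_p((t)); 15 crux lines already died on it.
sources: arXiv:math/0703678, doi:10.1016/j.jalgebra.2008.11.030, Literature.Barriers.ResolutionOfSingularities.InseparableBaseChange, EGAIV2, StacksProject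
PerfectToAll: for a prime p, resolution of all reduced separated finite-type schemes over all
PERFECT fields of char p implies ResolutionInChar p (all fields of char p). Expected inputs:
Neron-Popescu (Stacks 07GC), spreading out, openness of regular locus on excellent schemes;
regularity is not stable under inseparable ground field extension, which is the difficulty. -/
@[route_item "route-ResolutionOfSingularities-SeparableGalois", crux]
def DescentPerfectToAll : Prop :=
  ∀ p : ℕ, p.Prime → (∀ (k : Type) [Field k] [CharP k p] [PerfectField k] (X : AlgebraicGeometry.Scheme.{0}) (f : X ⟶ AlgebraicGeometry.Spec (.of k)), AlgebraicGeometry.IsSeparated f → AlgebraicGeometry.LocallyOfFiniteType f → AlgebraicGeometry.QuasiCompact f → AlgebraicGeometry.IsReduced X → Literature.AlgebraicGeometry.Resolution.Scheme.HasResolution X) → Literature.AlgebraicGeometry.Resolution.ResolutionInChar.{0} p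

/-- item stmt-ResolutionOfSingularities-18956 · assembly · rank 1 · closed · proved by Summit.ResolutionOfSingularities.ResolutionOfSingularities.Theorems.separableGalois_assembly_proof @ 95106d0fb104 (prover) · by planner
sources: DeJong1997, CossartPiltant2019
[assembly] GaloisQuotientModels → WildQuotientResolution → DescentPerfectToAll →
ResolutionOfSingularities. -/
@[route_item "route-ResolutionOfSingularities-SeparableGalois"]
def Assembly : Prop :=
  GaloisQuotientModels → WildQuotientResolution → DescentPerfectToAll → _root_.ResolutionOfSingularities

-- `Assembly` holds: proved by `Summit.ResolutionOfSingularities.ResolutionOfSingularities.Theorems.separableGalois_assembly_proof` @ 95106d0fb104 (its module imports this route file, so no `_holds` link can be stated here).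

/-! D-0027 §2.1 — DECIDING THEOREM (planner-authored via `route open/edit --closes-file`; by planner-plan-lens3-ResolutionOfSingularities-wuc-g2-0 2026-08-17T03:09:29Z):
its hypotheses are this route's items and its conclusion the sub-problem Statement (glue_lint), and it elaborates with this file. -/

/-- D-0027 §2.1 DECIDING THEOREM of route SeparableGalois (lens 3.10 wuc, cycle 2): the three cruxes imply the
summit statement `ResolutionOfSingularities` (by name). Fix a prime `p`; `DescentPerfectToAll p hp` reduces
`ResolutionInChar p` to reduced separated finite-type `X` over PERFECT `k`; the proved narrow-import Literature lemma
`ComponentGluing.hasResolution_of_forall_closeds` (Cossart–Piltant 2019 Prop 4.6 Step 1) reduces to the integral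
closed subschemes `Z ↪ X` (again separated of finite type over `k`); `GaloisQuotientModels` (W, a proved consequence
of the summit) gives `π : X₁ → Z` proper birational together with its Galois-quotient presentation `q : X′ → X₁`;
`WildQuotientResolution` (K, shared with route WildQuotients) resolves `X₁` (its structure map `X₁ → Z → X → Spec k`
is separated, locally of finite type, quasi-compact: instances from properness); the proved
`ComponentGluing.Scheme.HasResolution.of_isBirational` transports the resolution down `π`. Pure logic otherwise;
every crux is a binder and is used. -/
@[closes "route-ResolutionOfSingularities-SeparableGalois"] theorem closes (hW : GaloisQuotientModels) (hK : WildQuotientResolution) (hD : DescentPerfectToAll) :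
    _root_.ResolutionOfSingularities := by
  refine _root_.ResolutionOfSingularities_iff.mpr fun p hp => hD p hp ?_
  intro k _ _ _ X f hs hl hq hr
  refine Literature.AlgebraicGeometry.Resolution.ComponentGluing.hasResolution_of_forall_closeds X f fun Z hZ => ?_
  haveI := hZ
  obtain ⟨X₁, X', π, q, G, _, _, ρ, hπ, hbir, h1, h2, hreg, hfin, hsurj, het, hinv, horb⟩ :=
    hW p hp k _ (CategoryTheory.CategoryStruct.comp
      (AlgebraicGeometry.Scheme.IdealSheafData.vanishingIdeal Z).subschemeι f)
      inferInstance inferInstance inferInstance hZ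
  have hres : Literature.AlgebraicGeometry.Resolution.Scheme.HasResolution X₁ :=
    hK p hp k X' X₁ (CategoryTheory.CategoryStruct.comp π (CategoryTheory.CategoryStruct.comp
      (AlgebraicGeometry.Scheme.IdealSheafData.vanishingIdeal Z).subschemeι f)) q G ρ
      inferInstance inferInstance inferInstance h1 h2 hreg hfin hsurj het hinv horb
  exact Literature.AlgebraicGeometry.Resolution.ComponentGluing.Scheme.HasResolution.of_isBirational π hbir hres

end Summit.ResolutionOfSingularities.ResolutionOfSingularities.Theses.SeparableGalois
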